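import Summits.HodgeConjecture.CorCM.Model.Universe2Facts
import Summits.HodgeConjecture.CorCM.Model.CupRingFacts
import Summits.HodgeConjecture.CorCM.Model.CupHodge
import Summits.HodgeConjecture.CorCM.Model.CupExterior
import Summits.HodgeConjecture.CorCM.Model.ProdSection
import HarnessLib

/-!
# The open geometric inputs N1–N4, F4, F5 and `Fact_prodSection` for the second model universe `Model2.universe₂`

Cell `pub-hodgecm2` (COR-CM), seat model-2 (gen 2).  Road 2 of the E term runs the package chain
`Assembly.hc_cm_of_periodThmF` on `universe₂`; besides `ModelAxioms` (`Model2.modelAxioms₂_of`) it reads the nine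
textbook facts N1–N4, F2, F4–F7.  This file proves, for `universe₂ hHD hI hU h₃`:

* N1 `Fact_cupExterior` — at the CM products `cmProd F Θ`, whose interpretation is the abelian variety
  `Domination.cmProdAV F h₃ n Θ` (`Model2.scheme_cmProd_universe₂`): the tree's `wedgeToCup` /
  `hasExteriorCohomologyH1_rat` (p2), re-bracketed by model-2's `Model.cupPowOne_eq_snoc`;
* N2 `Fact_cup_hodge`, N3 `Fact_pull_H0`, N4 `Fact_hodge_F0`, F4 `Fact_cupAlg`, F5 `Fact_cupAssoc` — generic in the
  variety: the scheme-level theorems used for the model of record (`Model.bettiCupC_hodge`,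
  `H⁰ = ℚ · 1` of a path-connected `X(ℂ)`, `HodgeModel.ratF_of_nonpos`, `Voisin2003_cupProduct_algebraicClasses_holds`,
  `Motives.bettiCup_assoc`) at the `IsoComplete` codes;
* the content of `Fact_prodSection` (the model input of F2; unfolded shape, `universe₂_prodSection`) — generic:
  sections of the projections from a complex point of the other factor (`Model.exists_section_fst_of_point`, `…_snd_…`).

F2 and F6 follow by the package derivations once their cones land (`Model/Universe2FactorAct.lean`,
`Model/Universe2WeightDual.lean`); F7 with model-1's block Gysin.
-/

noncomputable section

open CategoryTheory
open Literature.AlgebraicGeometry.Motives (bettiCohomology bettiCup bettiOne IsSmoothProjective SchemeOver ComplexPoints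
  CMType)
open Literature.AlgebraicGeometry.Motives
open Literature.AlgebraicTopology.SingularHomology

namespace Summit.HodgeConjecture.CorCM

namespace Model2

open Literature.NumberTheory.Automorphic
open Literature.NumberTheory.Automorphic.PicardCM (BallQuotientUniformisedDatum CMAbelianVarietyRealised)
open Literature.AlgebraicGeometry.HodgeTheory
open Summit.HodgeConjecture.CorCM.Domination (cmProdAV)


/-! ### Degree transport and iterated cup products on `universe₂` -/

/-- The package's degree transport `castCoh` of `universe₂` along `e : m = m'` turns `bettiCup h` (`h : p + q = m`)
into `bettiCup (h.trans e)`. [folklore] -/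
theorem castCoh_bettiCup (hHD : exists_isReal_hodgeModel) (hI : hodgePQ_independent_of_hodgeModel)
    (hU : BallQuotientUniformisedDatum) (h₃ : CMAbelianVarietyRealised) (X : IsoComplete.Var) {p q m m' : ℕ} (h : p + q = m) (e : m = m')
    (x : (universe₂ hHD hI hU h₃).Coh X p) (y : (universe₂ hHD hI hU h₃).Coh X q) :
    (universe₂ hHD hI hU h₃).castCoh X e (bettiCup h x y) = bettiCup (h.trans e) x y := by
  subst e
  rfl

/-- The package's left-bracketed `cupPow X k a` on `universe₂` IS the tree's `cupPowOne ℚ _ (k+1) a`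
(re-bracketing `Model.cupPowOne_eq_snoc`). [cite: HatcherAT2002, §3.2 p. 211] -/
theorem cupPowOne_succ_eq_cupPow (hHD : exists_isReal_hodgeModel) (hI : hodgePQ_independent_of_hodgeModel)
    (hU : BallQuotientUniformisedDatum) (h₃ : CMAbelianVarietyRealised) (X : IsoComplete.Var) :
    ∀ (k : ℕ) (a : Fin (k + 1) → (universe₂ hHD hI hU h₃).Coh X 1),
      cupPowOne ℚ (ComplexPoints (IsoComplete.Var.scheme hU h₃ X)) (k + 1) a = (universe₂ hHD hI hU h₃).cupPow X k a
  | 0, a => cupPowOne_one ℚ _ a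
  | k + 1, a =>
      (Model.cupPowOne_eq_snoc (k + 1) a).trans
        (congrArg (fun z => cupProduct (rfl : k + 1 + 1 = k + 1 + 1) z (a (Fin.last (k + 1))))
          (cupPowOne_succ_eq_cupPow hHD hI hU h₃ X k (Fin.init a)))

/-! ### N1–N4 -/

/-- **N1 `Fact_cupExterior`** for `universe₂`: for the CM product `cmProd F Θ` (the abelian variety `cmProdAV F h₃ n Θ`
by `scheme_cmProd_universe₂`), `v₀ ∧ ⋯ ∧ v_k ↦ v₀ ∪ ⋯ ∪ v_k` is a linear bijection `⋀^{k+1} H¹ ≅ H^{k+1}`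
(`wedgeToCup`, `hasExteriorCohomologyH1_rat`). [cite: MumfordAV1970, §1 (3)–(4)] [cite: LangeBirkenhake1992, Lemma 1.1.17] -/
theorem universe₂_fact_cupExterior (hHD : exists_isReal_hodgeModel) (hI : hodgePQ_independent_of_hodgeModel)
    (hU : BallQuotientUniformisedDatum) (h₃ : CMAbelianVarietyRealised) : (universe₂ hHD hI hU h₃).Fact_cupExterior := by
  intro F n Θ k
  have hex : HasExteriorCohomologyH1 ℚ
      (ComplexPoints (IsoComplete.Var.scheme hU h₃ ((universe₂ hHD hI hU h₃).cmProd F Θ))) := by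
    rw [scheme_cmProd_universe₂ hHD hI hU h₃ F n Θ]
    exact Model.hasExteriorCohomologyH1_rat (cmProdAV F h₃ n Θ)
  exact ⟨wedgeToCup ℚ _ (k + 1), hex (k + 1), fun a ↦
    (wedgeToCup_ιMulti ℚ _ (k + 1) a).trans (cupPowOne_succ_eq_cupPow hHD hI hU h₃ _ k a)⟩

/-- **N2 `Fact_cup_hodge`** for `universe₂` (`Universe.cupC` IS `Model.bettiCupC` on the interpretation, definitionally;
`Model.bettiCupC_hodge`). [cite: VoisinHodgeI2002, §5.3.2 Thm. 5.29 and §7.1.2] -/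
theorem universe₂_fact_cup_hodge (hHD : exists_isReal_hodgeModel) (hI : hodgePQ_independent_of_hodgeModel)
    (hU : BallQuotientUniformisedDatum) (h₃ : CMAbelianVarietyRealised) : (universe₂ hHD hI hU h₃).Fact_cup_hodge :=
  fun X i j p q x y hx hy ↦ Model.bettiCupC_hodge hHD hI (IsoComplete.Var.isSmoothProjective hU h₃ X) i j p q x y hx hy

/-- **N3 `Fact_pull_H0`** for `universe₂`: an endomorphism acts trivially on `H⁰(X(ℂ); ℚ) = ℚ · 1` (`X(ℂ)` path
connected; `f^* 1 = 1`). [cite: HatcherAT2002, §3.1 p. 199] -/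
theorem universe₂_fact_pull_H0 (hHD : exists_isReal_hodgeModel) (hI : hodgePQ_independent_of_hodgeModel)
    (hU : BallQuotientUniformisedDatum) (h₃ : CMAbelianVarietyRealised) : (universe₂ hHD hI hU h₃).Fact_pull_H0 := by
  intro X f
  haveI := Model.pathConnectedSpace_complexPoints (IsoComplete.Var.isSmoothProjective hU h₃ X)
  refine LinearMap.ext fun z ↦ ?_
  change bettiCohomology.map f 0 z = z
  rw [Model.eq_smul_one_of_pathConnectedSpace_rat z, map_smul]
  change _ • bettiCohomology.map f 0 (bettiOne (IsoComplete.Var.scheme hU h₃ X)) = _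
  rw [bettiCohomology.map_one]

/-- **N4 `Fact_hodge_F0`** for `universe₂`: `F⁰ Hᵏ = Hᵏ` (`HodgeModel.ratF_of_nonpos`). [cite: VoisinHodgeI2002, §7.1.1] -/
theorem universe₂_fact_hodge_F0 (hHD : exists_isReal_hodgeModel) (hI : hodgePQ_independent_of_hodgeModel)
    (hU : BallQuotientUniformisedDatum) (h₃ : CMAbelianVarietyRealised) : (universe₂ hHD hI hU h₃).Fact_hodge_F0 := by
  intro X k
  change (BettiUniverse.hodge hHD (IsoComplete.Var.isSmoothProjective hU h₃ X) k).F 0 = ⊤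
  rw [BettiUniverse.hodge_F]
  exact HodgeModel.ratF_of_nonpos _ (IsoComplete.Var.isSmoothProjective hU h₃ X) k le_rfl

/-! ### F4, F5 -/

/-- **F4 `Fact_cupAlg`** for `universe₂`: the cup product of rational algebraic classes of codimensions `p`, `q` is a
rational algebraic class of codimension `p + q` (`Voisin2003_cupProduct_algebraicClasses_holds`, `ofRatClass_cupProduct`).
[cite: VoisinHodgeII2003, Prop. 9.20] -/
theorem universe₂_fact_cupAlg (hHD : exists_isReal_hodgeModel) (hI : hodgePQ_independent_of_hodgeModel)
    (hU : BallQuotientUniformisedDatum) (h₃ : CMAbelianVarietyRealised) : (universe₂ hHD hI hU h₃).Fact_cupAlg := by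
  intro X p q x y hx hy
  change (universe₂ hHD hI hU h₃).castCoh X _ (bettiCup rfl x y) ∈
    PicardCM.ratAlgebraicClasses (IsoComplete.Var.scheme hU h₃ X) (p + q)
  rw [castCoh_bettiCup]
  change ofRatClass (ComplexPoints (IsoComplete.Var.scheme hU h₃ X)) (2 * (p + q)) (cupProduct _ x y) ∈
    algebraicClasses (IsoComplete.Var.scheme hU h₃ X) (p + q)
  rw [Model.ofRatClass_cupProduct]
  exact Summit.HodgeConjecture.HodgeConjecture.Theorems.Voisin2003_cupProduct_algebraicClasses_holds
    (IsoComplete.Var.isSmoothProjective hU h₃ X) hx hy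

/-- **F5 `Fact_cupAssoc`** for `universe₂`: associativity of the cup product up to the degree transport
(`Motives.bettiCup_assoc`). [cite: HatcherAT2002, §3.2 p. 211] -/
theorem universe₂_fact_cupAssoc (hHD : exists_isReal_hodgeModel) (hI : hodgePQ_independent_of_hodgeModel)
    (hU : BallQuotientUniformisedDatum) (h₃ : CMAbelianVarietyRealised) : (universe₂ hHD hI hU h₃).Fact_cupAssoc := by
  intro X i j k a b c
  change bettiCup rfl (bettiCup rfl a b) c = (universe₂ hHD hI hU h₃).castCoh X _ (bettiCup rfl a (bettiCup rfl b c))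
  rw [castCoh_bettiCup]
  exact bettiCup_assoc rfl rfl rfl _ a b c

/-! ### `Fact_prodSection` (model input of F2) -/

/-- Every variety of the iso-complete universe has a complex point (`X(ℂ)` is connected, hence non-empty).
[folklore] -/
theorem nonempty_complexPoints_scheme (hU : BallQuotientUniformisedDatum) (h₃ : CMAbelianVarietyRealised) (v : IsoComplete.Var) :
    Nonempty (ComplexPoints (IsoComplete.Var.scheme hU h₃ v)) :=
  (connectedSpace_complexPoints (IsoComplete.Var.isSmoothProjective hU h₃ v)).toNonempty

/-- **`Fact_prodSection`** for `universe₂`, in the unfolded shape of `Model.var_prodSection` (the package's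
`Universe.Fact_prodSection` is stated in `Proofs/Pohlmann/FactorActDescent1`; the one-line junction lives with F2): both
projections of every binary product have sections (from a complex point of the other factor:
`Model.exists_section_fst_of_point`, `Model.exists_section_snd_of_point`). [folklore] -/
theorem universe₂_prodSection (hU : BallQuotientUniformisedDatum) (h₃ : CMAbelianVarietyRealised) (v w : IsoComplete.Var) :
    (∃ s : IsoComplete.Var.Mor hU h₃ v (.prod v w),
        IsoComplete.Var.comp hU h₃ s (IsoComplete.Var.fst hU h₃ v w) = IsoComplete.Var.idMor hU h₃ v) ∧
      (∃ s' : IsoComplete.Var.Mor hU h₃ w (.prod v w),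
        IsoComplete.Var.comp hU h₃ s' (IsoComplete.Var.snd hU h₃ v w) = IsoComplete.Var.idMor hU h₃ w) := by
  obtain ⟨y₀⟩ := nonempty_complexPoints_scheme hU h₃ w
  obtain ⟨x₀⟩ := nonempty_complexPoints_scheme hU h₃ v
  exact ⟨Model.exists_section_fst_of_point (IsoComplete.Var.scheme hU h₃ v) y₀,
    Model.exists_section_snd_of_point x₀ (IsoComplete.Var.scheme hU h₃ w)⟩

end Model2

end Summit.HodgeConjecture.CorCM

end
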